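import Mathlib

/-!
# Endgame (stub `stub_endgame` of line `Sketch`, crux `RazWigdersonMatching`)

Pure real-analysis endgame of the Raz–Wigderson lower bound for monotone formulas computing
bipartite perfect matching: with `u := ⌊(m-1)/2⌋`, the harmonic-profile inequality
`3^u / (u+1) ≤ (s+1) · 2^u · √2^u` forces `s ≥ 2^{c m}` for all large `m`, because `3 > 2√2`.

Proof: bound `√2 ≤ 17/12`, so the inequality gives `(18/17)^u ≤ (s+1)(u+1)`. Take
`c := log₂(18/17) / 4`; then `X := 2^{c m}` satisfies `X² ≤ (18/17)^{u+1}` (as `m ≤ 2u+2`).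
If `s < X` then `(18/17)^u < 2 X (u+1)`, and squaring gives
`(18/17)^{2u} < 4 (18/17)^{u+1} (u+1)²`, which fails for large `u` (exponential beats
quadratic, via `n² rⁿ → 0` for `|r| < 1`).
-/

set_option linter.dupNamespace false

noncomputable section

namespace Summit.ValiantsHypothesis.ValiantsHypothesis.Theorems.ShallowShadowsRazWigdersonMatching

open Filter Topology

/-- Exponential beats quadratic: eventually `4 · (18/17)^(u+1) · (u+1)² < ((18/17)^u)²`. -/
theorem endgame_growth :
    ∃ N : ℕ, ∀ u : ℕ, N ≤ u →
      4 * (18 / 17 : ℝ) ^ (u + 1) * ((u : ℝ) + 1) ^ 2 < ((18 / 17 : ℝ) ^ u) ^ 2 := by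
  have ht : Tendsto (fun n : ℕ => (n : ℝ) ^ 2 * (17 / 18 : ℝ) ^ n) atTop (𝓝 0) :=
    tendsto_pow_const_mul_const_pow_of_abs_lt_one 2
      (by rw [abs_of_pos (by norm_num)]; norm_num)
  have ht' := ht.comp (tendsto_add_atTop_nat 1)
  have hev := ht'.eventually_lt_const (show (0 : ℝ) < 1 / 8 by norm_num)
  obtain ⟨N, hN⟩ := eventually_atTop.1 hev
  refine ⟨N, fun u hu => ?_⟩
  have h : ((u : ℝ) + 1) ^ 2 * (17 / 18 : ℝ) ^ (u + 1) < 1 / 8 := by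
    have := hN u hu
    simp only [Function.comp_apply] at this
    push_cast at this
    linarith
  have hr : (0 : ℝ) < (18 / 17) ^ (u + 1) := by positivity
  have key : ((u : ℝ) + 1) ^ 2 < (18 / 17 : ℝ) ^ (u + 1) / 8 := by
    have h1 : (17 / 18 : ℝ) ^ (u + 1) * (18 / 17) ^ (u + 1) = 1 := by
      rw [← mul_pow]; norm_num
    have h2 := mul_lt_mul_of_pos_right h hr
    rw [mul_assoc, h1, mul_one] at h2
    linarith
  calc 4 * (18 / 17 : ℝ) ^ (u + 1) * ((u : ℝ) + 1) ^ 2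
      < 4 * (18 / 17 : ℝ) ^ (u + 1) * ((18 / 17 : ℝ) ^ (u + 1) / 8) :=
        mul_lt_mul_of_pos_left key (by positivity)
    _ = ((18 / 17 : ℝ) ^ u) ^ 2 * ((18 / 17) ^ 2 / 2) := by ring
    _ ≤ ((18 / 17 : ℝ) ^ u) ^ 2 * 1 := by gcongr; norm_num
    _ = ((18 / 17 : ℝ) ^ u) ^ 2 := by ring

/-- **Endgame** (`stub_endgame`): from `3^u/(u+1) ≤ (s+1)·2^u·√2^u` with `u = ⌊(m-1)/2⌋`,
conclude `2^{c m} ≤ s` for all `m ≥ m₀`, for an absolute constant `c > 0`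
(here `c = log₂(18/17)/4`). -/
theorem stub_endgame :
    ∃ c : ℝ, 0 < c ∧ ∃ m₀ : ℕ, ∀ m : ℕ, m₀ ≤ m → ∀ s : ℕ,
      (3 : ℝ) ^ ((m - 1) / 2) / ((((m - 1) / 2 : ℕ) : ℝ) + 1) ≤
          ((s : ℝ) + 1) * ((2 : ℝ) ^ ((m - 1) / 2) * Real.sqrt 2 ^ ((m - 1) / 2)) →
        (2 : ℝ) ^ (c * m) ≤ s := by
  obtain ⟨N, hN⟩ := endgame_growth
  have hr1 : (1 : ℝ) < 18 / 17 := by norm_num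
  have hr0 : (0 : ℝ) < 18 / 17 := by norm_num
  have hc0 : 0 < Real.logb 2 (18 / 17) / 4 :=
    div_pos (Real.logb_pos (by norm_num) hr1) (by norm_num)
  refine ⟨Real.logb 2 (18 / 17) / 4, hc0, 2 * N + 1, ?_⟩
  intro m hm s hs
  generalize hu : (m - 1) / 2 = u at hs
  have hNu : N ≤ u := by omega
  have hmu : (m : ℝ) ≤ 2 * u + 2 := by exact_mod_cast (show m ≤ 2 * u + 2 by omega)
  -- Step 1: `√2 ≤ 17/12`.
  have hsqrt : Real.sqrt 2 ≤ 17 / 12 := by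
    rw [Real.sqrt_le_left (by norm_num)]; norm_num
  -- Step 2: `(18/17)^u ≤ (s+1)(u+1)`.
  have hu1 : (0 : ℝ) < (u : ℝ) + 1 := by positivity
  have hs1 : (3 : ℝ) ^ u ≤ ((s : ℝ) + 1) * ((u : ℝ) + 1) * (17 / 6 : ℝ) ^ u := by
    have h1 : (3 : ℝ) ^ u ≤ ((s : ℝ) + 1) * ((2 : ℝ) ^ u * Real.sqrt 2 ^ u) * ((u : ℝ) + 1) :=
      (div_le_iff₀ hu1).1 hs
    have h2 : (2 : ℝ) ^ u * Real.sqrt 2 ^ u ≤ (17 / 6 : ℝ) ^ u := by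
      rw [← mul_pow]
      exact pow_le_pow_left₀ (by positivity) (by linarith) u
    calc (3 : ℝ) ^ u ≤ ((s : ℝ) + 1) * ((2 : ℝ) ^ u * Real.sqrt 2 ^ u) * ((u : ℝ) + 1) := h1
      _ ≤ ((s : ℝ) + 1) * (17 / 6 : ℝ) ^ u * ((u : ℝ) + 1) := by gcongr
      _ = _ := by ring
  have hT : (18 / 17 : ℝ) ^ u ≤ ((s : ℝ) + 1) * ((u : ℝ) + 1) := by
    have h3 : (3 : ℝ) ^ u = (18 / 17 : ℝ) ^ u * (17 / 6 : ℝ) ^ u := by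
      rw [← mul_pow]; norm_num
    rw [h3] at hs1
    exact le_of_mul_le_mul_right hs1 (by positivity)
  -- Step 3: `X := 2^{c m}` satisfies `1 ≤ X` and `X² ≤ (18/17)^(u+1)`.
  have hX1 : (1 : ℝ) ≤ (2 : ℝ) ^ (Real.logb 2 (18 / 17) / 4 * (m : ℝ)) :=
    Real.one_le_rpow (by norm_num) (mul_nonneg hc0.le (Nat.cast_nonneg m))
  have hX2 : ((2 : ℝ) ^ (Real.logb 2 (18 / 17) / 4 * (m : ℝ))) ^ 2 ≤ (18 / 17 : ℝ) ^ (u + 1) := by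
    have h4 : (2 : ℝ) ^ (Real.logb 2 (18 / 17) / 4 * (m : ℝ)) ≤
        (2 : ℝ) ^ (Real.logb 2 (18 / 17) / 4 * (2 * u + 2)) :=
      Real.rpow_le_rpow_of_exponent_le (by norm_num) (mul_le_mul_of_nonneg_left hmu hc0.le)
    calc ((2 : ℝ) ^ (Real.logb 2 (18 / 17) / 4 * (m : ℝ))) ^ 2
        ≤ ((2 : ℝ) ^ (Real.logb 2 (18 / 17) / 4 * (2 * u + 2))) ^ 2 := by gcongr
      _ = (2 : ℝ) ^ (Real.logb 2 (18 / 17) * ((u + 1 : ℕ) : ℝ)) := by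
          rw [← Real.rpow_natCast, ← Real.rpow_mul (by norm_num)]
          congr 1
          push_cast
          ring
      _ = (18 / 17 : ℝ) ^ (u + 1) := by
          rw [Real.rpow_mul_natCast (by norm_num), Real.rpow_logb (by norm_num) (by norm_num) hr0]
  -- Step 4: contradiction with the growth lemma.
  by_contra hlt
  rw [not_le] at hlt
  have h5 : (18 / 17 : ℝ) ^ u < 2 * (2 : ℝ) ^ (Real.logb 2 (18 / 17) / 4 * (m : ℝ)) *
      ((u : ℝ) + 1) := by
    calc (18 / 17 : ℝ) ^ u ≤ ((s : ℝ) + 1) * ((u : ℝ) + 1) := hT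
      _ < ((2 : ℝ) ^ (Real.logb 2 (18 / 17) / 4 * (m : ℝ)) + 1) * ((u : ℝ) + 1) := by gcongr
      _ ≤ 2 * (2 : ℝ) ^ (Real.logb 2 (18 / 17) / 4 * (m : ℝ)) * ((u : ℝ) + 1) := by
          gcongr; linarith
  have h6 : ((18 / 17 : ℝ) ^ u) ^ 2 < 4 * (18 / 17 : ℝ) ^ (u + 1) * ((u : ℝ) + 1) ^ 2 := by
    calc ((18 / 17 : ℝ) ^ u) ^ 2
        < (2 * (2 : ℝ) ^ (Real.logb 2 (18 / 17) / 4 * (m : ℝ)) * ((u : ℝ) + 1)) ^ 2 :=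
          pow_lt_pow_left₀ h5 (by positivity) two_ne_zero
      _ = 4 * ((2 : ℝ) ^ (Real.logb 2 (18 / 17) / 4 * (m : ℝ))) ^ 2 * ((u : ℝ) + 1) ^ 2 := by
          ring
      _ ≤ 4 * (18 / 17 : ℝ) ^ (u + 1) * ((u : ℝ) + 1) ^ 2 := by gcongr
  have h7 := hN u hNu
  linarith

end Summit.ValiantsHypothesis.ValiantsHypothesis.Theorems.ShallowShadowsRazWigdersonMatching

end
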